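import Summits.RiemannHypothesis.RiemannHypothesis.Theorems.JensenPolynomialsDefs

/-!
# Route `JensenPolynomials` — TABLE crux, part 1: the closed form of GORTTW's Hermite coefficients

ξ-free algebra for the kernel packaging of the TABLE crux
`XiGorttwCoeffSmallBelow rhoWinMin 10000` (route «JensenPolynomials», rung J-P(P1′); RH-FREE proof-of-data).
For ANY real sequence `γ` with `γ(M) ≠ 0`, `γ(M−1) ≠ 0`, `Δ(M)² > 0` (`M = n + d`) we prove

* `coeff_mul_delta_pow`:  `[X^k] J̃^{d,n} · Δ^d = S_k · Δ^k`, where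
  `S_k = Σ_{k ≤ l ≤ d} C(d,l) C(l,k) (−1)^{l−k} · w_{d−l}(M)` and `w_i(M) = γ(M−i)γ(M)^{i−1}/γ(M−1)^i`
  (`= windowSeqDown γ M i` for `i ≥ 1`, `w_0 = 1`) — from GORTTW's substitution `X ↦ r(ΔX − 1)`
  [GriffinEtAl2022, (2.4)];
* `gorttwCoeff_mul_delta_pow`: `c_{d,n,j} · Δ^j = T_j := Σ_{2i ≤ j} (Δ²)^i · (d−j+2i)!/(i!(d−j)!) · S_{d−j+2i}`
  (Hermite coordinates, [DLMF, 18.18.20] at `X/2`), `j ≤ d`.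

So `c_{d,n,j}·Δ^j` is a polynomial in the window ratios `w_i` and `Δ² = (1 − w_2)/2` with rational coefficients:
the quantity the interval checker of part 2 (`JensenPolynomialsXiGorttwCoeffSmallTableCheck`) encloses from ratio boxes for
`γ(m+1)/γ(m)`. The coefficient lemmas `coeff_affine_pow` … `coeff_gorttwNormalised` and the range lemma for
`hermiteCoord` are re-proved here after the theory seat's HOME file `JensenTargets.lean` v4.6 §8.6 (sub-namespace
`CoeffTable`, so the port of §8.6 keeps its names). Nothing here bears on the truth of RH.
-/

-- D-0017: `Summit.RiemannHypothesis.RiemannHypothesis.…` duplicates the namespace BY DESIGN (single-problem summit).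
set_option linter.dupNamespace false

namespace Summit.RiemannHypothesis.RiemannHypothesis.Theorems.JensenPolynomials.CoeffTable

open Literature.NumberTheory.LFunctions Polynomial Finset
open scoped BigOperators Nat

/-! ## Window ratios with the correct value at index `0` -/

/-- `w_i(M) := γ(M−i)·γ(M)^i/(γ(M−1)^i·γ(M))` (`= 1` at `i = 0`, `= windowSeqDown γ M i` for `i ≥ 1` when
`γ(M) ≠ 0`). -/
noncomputable def wR (γ : ℕ → ℝ) (M i : ℕ) : ℝ := γ (M - i) * γ M ^ i / (γ (M - 1) ^ i * γ M)

/-- `w_0 = 1`. -/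
theorem wR_zero {γ : ℕ → ℝ} {M : ℕ} (hM : γ M ≠ 0) : wR γ M 0 = 1 := by
  unfold wR; simp [hM]

/-- `w_i = windowSeqDown γ M i` for `i ≥ 1`. -/
theorem wR_eq_windowSeqDown {γ : ℕ → ℝ} {M i : ℕ} (hM : γ M ≠ 0) (hi : 1 ≤ i) :
    wR γ M i = windowSeqDown γ M i := by
  unfold wR windowSeqDown
  obtain ⟨e, rfl⟩ : ∃ e, i = e + 1 := ⟨i - 1, by omega⟩
  rw [Nat.add_sub_cancel, pow_succ]
  field_simp

/-- The recurrence `w_{i+1} = w_i · (γ(M)/γ(M−1)) / (γ(M−i)/γ(M−i−1))`. -/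
theorem wR_succ {γ : ℕ → ℝ} {M i : ℕ} (hM : γ M ≠ 0) (hM1 : γ (M - 1) ≠ 0) (hMi : γ (M - i) ≠ 0)
    (hMi1 : γ (M - (i + 1)) ≠ 0) :
    wR γ M (i + 1) = wR γ M i * (γ M / γ (M - 1)) / (γ (M - i) / γ (M - (i + 1))) := by
  unfold wR
  rw [pow_succ, pow_succ]
  field_simp

/-! ## The scaled coefficients `S_k` and the scaled Hermite coordinates `T_j` -/

/-- Integer coefficient `C(d,l)·C(l,k)·(−1)^{l−k}`. -/
def sCoef (d l k : ℕ) : ℤ := ((d.choose l : ℕ) : ℤ) * ((l.choose k : ℕ) : ℤ) * (-1) ^ (l - k)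

/-- `S_k(d,n) := Σ_{k ≤ l ≤ d} C(d,l)C(l,k)(−1)^{l−k} w_{d−l}(n+d)`. -/
noncomputable def sR (γ : ℕ → ℝ) (d n k : ℕ) : ℝ :=
  ∑ l ∈ range (d + 1), if k ≤ l then (sCoef d l k : ℝ) * wR γ (n + d) (d - l) else 0

/-- The positive rational `(d−j+2i)!/(i!·(d−j)!)` of the Hermite inversion. -/
def qCoef (d j i : ℕ) : ℚ := ((d - j + 2 * i)! : ℚ) / (((i)! : ℚ) * ((d - j)! : ℚ))

/-- `T_j(d,n) := Σ_{i ≤ j/2} (Δ²)^i · qCoef(d,j,i) · S_{d−j+2i}`. -/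
noncomputable def tR (γ : ℕ → ℝ) (d n j : ℕ) : ℝ :=
  ∑ i ∈ range (j / 2 + 1),
    gorttwDeltaSq γ (n + d) ^ i * (qCoef d j i : ℝ) * sR γ d n (d - j + 2 * i)

/-! ## Coefficients of the normalised polynomial (after HOME JensenTargets v4.6 §8.6) -/

/-- Coefficients of a power of an affine polynomial. -/
theorem coeff_affine_pow (a b : ℝ) (j k : ℕ) :
    ((C a * X + C b) ^ j).coeff k = if k ≤ j then (j.choose k : ℝ) * a ^ k * b ^ (j - k) else 0 := by
  rw [add_pow, finsetSum_coeff]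
  have hterm : ∀ m ∈ range (j + 1),
      ((C a * X) ^ m * C b ^ (j - m) * (j.choose m : ℝ[X])).coeff k =
        if k = m then (j.choose k : ℝ) * a ^ k * b ^ (j - k) else 0 := by
    intro m _
    have : (C a * X) ^ m * C b ^ (j - m) * (j.choose m : ℝ[X]) =
        C (a ^ m * b ^ (j - m) * (j.choose m : ℝ)) * X ^ m := by
      rw [mul_pow, ← C_pow, ← C_pow, ← map_natCast C (j.choose m), C_mul, C_mul]; ring
    rw [this, coeff_C_mul_X_pow]
    by_cases h : k = m
    · subst h; simp only [if_true]; ring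
    · rw [if_neg h, if_neg h]
  rw [sum_congr rfl hterm]
  simp [Finset.sum_ite_eq]

/-- Composition distributes over finite sums. -/
theorem finset_sum_comp (s : Finset ℕ) (f : ℕ → ℝ[X]) (q : ℝ[X]) :
    (∑ k ∈ s, f k).comp q = ∑ k ∈ s, (f k).comp q :=
  map_sum (compRingHom q) f s

/-- Coefficients of `J^{d,n} ∘ (aX + b)`. -/
theorem coeff_jensenPoly_comp_affine (γ : ℕ → ℝ) (d n : ℕ) (a b : ℝ) (k : ℕ) :
    ((jensenPoly γ d n).comp (C a * X + C b)).coeff k =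
      ∑ j ∈ range (d + 1), ((d.choose j : ℝ) * γ (n + j)) *
        (if k ≤ j then (j.choose k : ℝ) * a ^ k * b ^ (j - k) else 0) := by
  unfold jensenPoly
  rw [finset_sum_comp, finsetSum_coeff]
  refine sum_congr rfl fun j _ => ?_
  rw [mul_comp, C_comp, X_pow_comp, coeff_C_mul, coeff_affine_pow]

/-- Coefficients of `J̃^{d,n}` [GriffinEtAl2022, (2.4)]. -/
theorem coeff_gorttwNormalised (γ : ℕ → ℝ) (d n k : ℕ) :
    (gorttwNormalised γ d n).coeff k = gorttwA γ d n *
      ∑ j ∈ range (d + 1), ((d.choose j : ℝ) * γ (n + j)) *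
        (if k ≤ j then (j.choose k : ℝ) * (gorttwR γ (n + d) * gorttwDelta γ (n + d)) ^ k *
          (-gorttwR γ (n + d)) ^ (j - k) else 0) := by
  unfold gorttwNormalised
  rw [coeff_C_mul, coeff_jensenPoly_comp_affine]

/-- `deg J̃^{d,n} ≤ d`. -/
theorem natDegree_gorttwNormalised_le (γ : ℕ → ℝ) (d n : ℕ) : (gorttwNormalised γ d n).natDegree ≤ d := by
  unfold gorttwNormalised
  refine (natDegree_C_mul_le _ _).trans (natDegree_comp_le.trans ?_)
  have h1 : (jensenPoly γ d n).natDegree ≤ d := by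
    unfold jensenPoly
    refine natDegree_sum_le_of_forall_le _ _ fun j hj => ?_
    refine (natDegree_C_mul_le _ _).trans ?_
    rw [natDegree_X_pow]
    exact Nat.lt_succ_iff.mp (Finset.mem_range.mp hj)
  calc (jensenPoly γ d n).natDegree *
        (C (gorttwR γ (n + d) * gorttwDelta γ (n + d)) * X + C (-gorttwR γ (n + d))).natDegree
      ≤ d * 1 := Nat.mul_le_mul h1 natDegree_linear_le
    _ = d := mul_one d

/-- `hermiteCoord` with ANY summation range beyond which the relevant coefficients vanish. -/
theorem hermiteCoord_eq_sum_range (p : ℝ[X]) (k N : ℕ) (hN : ∀ i, N ≤ i → p.coeff (k + 2 * i) = 0) :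
    hermiteCoord p k =
      ∑ i ∈ range N, p.coeff (k + 2 * i) * (((k + 2 * i)! : ℝ) / ((i ! : ℝ) * (k ! : ℝ))) := by
  unfold hermiteCoord
  have h1 : ∑ i ∈ range (p.natDegree + 1), p.coeff (k + 2 * i) * (((k + 2 * i)! : ℝ) / ((i ! : ℝ) * (k ! : ℝ)))
      = ∑ i ∈ range (max N (p.natDegree + 1)),
          p.coeff (k + 2 * i) * (((k + 2 * i)! : ℝ) / ((i ! : ℝ) * (k ! : ℝ))) := by
    apply sum_subset (range_mono (by omega))
    intro i hi his
    have : p.natDegree < k + 2 * i := by simp only [mem_range, not_lt] at hi his; omega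
    rw [coeff_eq_zero_of_natDegree_lt this, zero_mul]
  have h2 : ∑ i ∈ range N, p.coeff (k + 2 * i) * (((k + 2 * i)! : ℝ) / ((i ! : ℝ) * (k ! : ℝ)))
      = ∑ i ∈ range (max N (p.natDegree + 1)),
          p.coeff (k + 2 * i) * (((k + 2 * i)! : ℝ) / ((i ! : ℝ) * (k ! : ℝ))) := by
    apply sum_subset (range_mono (by omega))
    intro i hi his
    simp only [mem_range, not_lt] at hi his
    rw [hN i his, zero_mul]
  rw [h1, h2]

/-! ## The two identities -/

/-- **`[X^k] J̃^{d,n} · Δ^d = S_k · Δ^k`** for `k ≤ d` (non-degenerate frame). -/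
theorem coeff_mul_delta_pow {γ : ℕ → ℝ} {d n k : ℕ} (hk : k ≤ d) (hM : γ (n + d) ≠ 0)
    (hM1 : γ (n + d - 1) ≠ 0) (hΔ : 0 < gorttwDeltaSq γ (n + d)) :
    (gorttwNormalised γ d n).coeff k * gorttwDelta γ (n + d) ^ d =
      sR γ d n k * gorttwDelta γ (n + d) ^ k := by
  have hΔ' : gorttwDelta γ (n + d) ≠ 0 := (Real.sqrt_pos.mpr hΔ).ne'
  have _hk := hk
  rw [coeff_gorttwNormalised, sR, mul_assoc, mul_comm _ (gorttwDelta γ (n + d) ^ d), ← mul_assoc,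
    Finset.mul_sum, Finset.sum_mul]
  refine sum_congr rfl fun l hl => ?_
  have hld : l ≤ d := Nat.lt_succ_iff.mp (mem_range.mp hl)
  by_cases hkl : k ≤ l
  · rw [if_pos hkl, if_pos hkl]
    obtain ⟨e, rfl⟩ : ∃ e, l = k + e := ⟨l - k, by omega⟩
    obtain ⟨f, rfl⟩ : ∃ f, d = k + e + f := ⟨d - (k + e), by omega⟩
    unfold sCoef wR gorttwA gorttwR
    set Δ := gorttwDelta γ (n + (k + e + f))
    have hMdl : n + (k + e + f) - (k + e + f - (k + e)) = n + (k + e) := by omega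
    have hsub1 : k + e - k = e := by omega
    have hsub2 : k + e + f - (k + e) = f := by omega
    rw [hMdl, hsub1, hsub2]
    push_cast
    have hM' : γ (n + k + e + f) ≠ 0 := by
      rw [show n + k + e + f = n + (k + e + f) by omega]; exact hM
    have hM1' : γ (n + k + e + f - 1) ≠ 0 := by
      rw [show n + k + e + f - 1 = n + (k + e + f) - 1 by omega]; exact hM1
    rw [neg_pow]
    simp only [mul_pow, div_pow]
    field_simp
    ring
  · rw [if_neg hkl, if_neg hkl]; simp

/-- **`c_{d,n,j} · Δ^j = T_j`** for `j ≤ d` (non-degenerate frame): GORTTW's `j`-th Hermite coefficient times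
`Δ^j` is the explicit polynomial `tR` in the window ratios and `Δ²`. -/
theorem gorttwCoeff_mul_delta_pow {γ : ℕ → ℝ} {d n j : ℕ} (hj : j ≤ d) (hM : γ (n + d) ≠ 0)
    (hM1 : γ (n + d - 1) ≠ 0) (hΔ : 0 < gorttwDeltaSq γ (n + d)) :
    gorttwCoeff γ d n j * gorttwDelta γ (n + d) ^ j = tR γ d n j := by
  have hdeg := natDegree_gorttwNormalised_le γ d n
  have _hj := hj
  set Δ := gorttwDelta γ (n + d) with hΔdef
  have hΔpos : 0 < Δ := Real.sqrt_pos.mpr hΔ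
  have hΔsq : Δ ^ 2 = gorttwDeltaSq γ (n + d) := by
    rw [hΔdef]; unfold gorttwDelta; rw [Real.sq_sqrt hΔ.le]
  unfold gorttwCoeff tR
  rw [hermiteCoord_eq_sum_range _ (d - j) (j / 2 + 1) (fun i hi =>
    coeff_eq_zero_of_natDegree_lt (by omega)), Finset.sum_mul]
  refine sum_congr rfl fun i hi => ?_
  have hi' : i ≤ j / 2 := Nat.lt_succ_iff.mp (mem_range.mp hi)
  have hk : d - j + 2 * i ≤ d := by omega
  have key := coeff_mul_delta_pow (γ := γ) hk hM hM1 hΔ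
  have hc : (gorttwNormalised γ d n).coeff (d - j + 2 * i) * Δ ^ j =
      sR γ d n (d - j + 2 * i) * gorttwDeltaSq γ (n + d) ^ i := by
    have hne : Δ ^ d ≠ 0 := pow_ne_zero _ hΔpos.ne'
    rw [← hΔsq]
    have h1 : (gorttwNormalised γ d n).coeff (d - j + 2 * i) * Δ ^ j * Δ ^ d =
        sR γ d n (d - j + 2 * i) * (Δ ^ 2) ^ i * Δ ^ d := by
      calc (gorttwNormalised γ d n).coeff (d - j + 2 * i) * Δ ^ j * Δ ^ d
          = ((gorttwNormalised γ d n).coeff (d - j + 2 * i) * Δ ^ d) * Δ ^ j := by ring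
        _ = sR γ d n (d - j + 2 * i) * Δ ^ (d - j + 2 * i) * Δ ^ j := by rw [key]
        _ = sR γ d n (d - j + 2 * i) * Δ ^ (d - j + 2 * i + j) := by ring
        _ = sR γ d n (d - j + 2 * i) * Δ ^ (d + 2 * i) := by
            rw [show d - j + 2 * i + j = d + 2 * i by omega]
        _ = sR γ d n (d - j + 2 * i) * (Δ ^ 2) ^ i * Δ ^ d := by ring
    exact mul_right_cancel₀ hne h1
  have hq : (((d - j + 2 * i)! : ℝ) / ((i ! : ℝ) * ((d - j)! : ℝ))) = (qCoef d j i : ℝ) := by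
    unfold qCoef; push_cast; ring
  calc (gorttwNormalised γ d n).coeff (d - j + 2 * i) * (((d - j + 2 * i)! : ℝ) / ((i ! : ℝ) * ((d - j)! : ℝ)))
        * Δ ^ j = ((gorttwNormalised γ d n).coeff (d - j + 2 * i) * Δ ^ j) * (qCoef d j i : ℝ) := by
        rw [hq]; ring
    _ = gorttwDeltaSq γ (n + d) ^ i * (qCoef d j i : ℝ) * sR γ d n (d - j + 2 * i) := by
        rw [hc]; ring

end Summit.RiemannHypothesis.RiemannHypothesis.Theorems.JensenPolynomials.CoeffTable
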